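import Summits.HubbardSuperconductivity.HubbardLadder.ClusterCutOct12It4Frame00
import Summits.HubbardSuperconductivity.HubbardLadder.ClusterCutOct12It4Frame01
import Summits.HubbardSuperconductivity.HubbardLadder.ClusterCutOct12It4Frame02
import Summits.HubbardSuperconductivity.HubbardLadder.ClusterCutOct12It4Frame03
import Summits.HubbardSuperconductivity.HubbardLadder.ClusterCutOct12It4Frame04
import Summits.HubbardSuperconductivity.HubbardLadder.ClusterCutOct12It4Frame05
import Summits.HubbardSuperconductivity.HubbardLadder.ClusterCutOct12It4Frame06
import Summits.HubbardSuperconductivity.HubbardLadder.ClusterCutOct12It4Frame07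
import Summits.HubbardSuperconductivity.HubbardLadder.ClusterCutOct12It4Frame08
import Summits.HubbardSuperconductivity.HubbardLadder.ClusterCutOct12It4Frame09
import Summits.HubbardSuperconductivity.HubbardLadder.ClusterCutOct12It4Frame10
import Summits.HubbardSuperconductivity.HubbardLadder.ClusterCutOct12It4Frame11
import Summits.HubbardSuperconductivity.HubbardLadder.ClusterCutOct12Seam
import Summits.HubbardSuperconductivity.HubbardLadder.Oct12It4RowOfH0
import HarnessLib

/-!
# The cluster pair-cut row it4_s4b — HEAD OF RECORD, hypothesis-free

HONEST FRAMING: ladder R1–R4 with certified numbers; no claim on H/H₀; first certified bounds; not a superconductivity verdict.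
Cell pub-hubbard, lane r2-eng-1 (g13); desk LEAD g32 INBOX l.5255 (head of record `MANIFEST-ROW-it4s4b.txt` 006130a381599c81) and l.5324
(ruling: the last per-cut module of the eng-1 lineage may conclude the head from the tree's `oct12_it4_s4b_row_of_hblk`).

ASSEMBLY of the [C] road for the cut `cut_oct12_adv15oct12it4_s4b.json` b549640712040acb (σ = −931/5000, DEN = 10⁶):
* the twelve symmetry pieces `oct12Piece b = algOp (oct12SymRep 2) (oct12Table b / 16)` are Hermitian, idempotent, commute with
  `X_P = pairOp it4P` and resolve every vector (`oct12_pieces`, GroupAlgebraPieces; `xIt4 = 2 • X_P`, ClusterCutOct12It4Data);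
* the SEAM `16 • oct12Piece b e_σ = colVec (orbitVec (oct12GList (oct12Table b)) (code σ))` (ClusterCutOct12Seam);
* the twelve kernel frame certificates `it4Frame00 … it4Frame11` (ClusterCutOct12It4Frame00–11: SPAN on the 924 half-filling codes, the row
  checks of the literal blocks `Q_b = 65536·(B_b + 744800·G_b)`, and `Q_b ⪰ 0` by `PsdCert`), giving per piece
  `(−744800/4)·‖P_b v‖² ≤ Re⟨P_b v, X_P P_b v⟩`, i.e. `(2·DEN·σ)·‖P_b v‖² ≤ Re⟨P_b v, xIt4 P_b v⟩` on `S^z_tot v = 0` — the hypothesis `hblk`;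
* `oct12_it4_s4b_row_of_hblk` (Oct12It4RowOfH0: `rayleigh_ge_of_pieces` → [D] weight-zero reduction → torus window [A]+[R] → bookkeeping).
RESULT `oct12_it4_s4b_row`: for every `L ≥ 4`, `σ ≤ Σ_r 3 A_r c_L(r)` with the seven class sums of the cut — the XCUT row used by the
no. 214 certificate B2 0b612e26cb2a238e at even `L = 2k ≥ 22`.  Axioms: propext, Classical.choice, Quot.sound (kernel-decided facts by
`decide +kernel` only).  All statements [folklore] except the head, which is this cell's theorem.
-/

namespace Summit.HubbardSuperconductivity.HubbardLadder.ClusterCut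

open Matrix Literature.MathematicalPhysics.QuantumLattice

/-- `X_P = pairOp it4P` commutes with the full oct12 symmetry representation (from `xIt4 = 2 • X_P` and `xIt4_commute_oct12SymRep`). [folklore] -/
theorem pairOp_it4P_commute_oct12SymRep (g : Oct12Sym) :
    pairOp (toPairList 12 it4P (by norm_num)) * oct12SymRep 2 g = oct12SymRep 2 g * pairOp (toPairList 12 it4P (by norm_num)) := by
  have h := xIt4_commute_oct12SymRep g
  rw [xIt4_eq_two_smul_pairOp, Matrix.smul_mul, Matrix.mul_smul] at h
  exact smul_right_injective _ (two_ne_zero' ℂ) h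

/-- Each oct12 piece is Hermitian. [folklore] -/
theorem oct12Piece_conjTranspose (b : Fin 12) : (oct12Piece b)ᴴ = oct12Piece b :=
  (oct12_pieces (oct12SymRep 2) (conjTranspose_oct12SymRep 2) pairOp_it4P_commute_oct12SymRep).1 b

/-- Each oct12 piece is idempotent on vectors. [folklore] -/
theorem oct12Piece_idem (b : Fin 12) (w : TensorIndex (Fin 12) 2 → ℂ) :
    oct12Piece b *ᵥ (oct12Piece b *ᵥ w) = oct12Piece b *ᵥ w := by
  obtain ⟨_, horth, _, hsum⟩ := oct12_pieces (oct12SymRep 2) (conjTranspose_oct12SymRep 2) pairOp_it4P_commute_oct12SymRep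
  rw [Matrix.mulVec_mulVec]
  exact piece_idem_apply oct12Piece horth (hsum w) b

/-- Each oct12 piece commutes with `X_P = pairOp it4P`. [folklore] -/
theorem oct12Piece_comm_pairOp (b : Fin 12) :
    oct12Piece b * pairOp (toPairList 12 it4P (by norm_num)) = pairOp (toPairList 12 it4P (by norm_num)) * oct12Piece b :=
  ((oct12_pieces (oct12SymRep 2) (conjTranspose_oct12SymRep 2) pairOp_it4P_commute_oct12SymRep).2.2.1 b).symm

/-- The SEAM for the pieces: `16 • oct12Piece b e_σ` is the kernel's signed orbit sum of the code of `σ`. [folklore] -/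
theorem oct12Piece_seam (b : Fin 12) (σ : Fin 12 → Fin 2) :
    ((16 : ℕ) : ℂ) • (oct12Piece b *ᵥ Pi.single σ 1) = colVec 12 (orbitVec 12 (oct12GList (oct12Table b)) (encodeBits σ)) := by
  rw [Nat.cast_ofNat]
  exact oct12_seam (oct12Table b) σ

/-- **`hblk` DISCHARGED**: on every piece, the weight-zero Rayleigh bound `(2·DEN·σ)·‖P_b v‖² ≤ Re⟨P_b v, xIt4 P_b v⟩`
(`2·DEN·σ = 2000000·(−931/5000) = −372400`), from the twelve kernel frame certificates. -/
theorem it4_hblk : ∀ (b : Fin 12) (v : TensorIndex (Fin 12) 2 → ℂ), (totalSpin 1 2 : Op (Fin 12) 2) *ᵥ v = 0 →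
    (2000000 * ((-931 : ℝ) / 5000)) * (star (oct12Piece b *ᵥ v) ⬝ᵥ (oct12Piece b *ᵥ v)).re ≤
      (star (oct12Piece b *ᵥ v) ⬝ᵥ xIt4 *ᵥ (oct12Piece b *ᵥ v)).re := by
  have key : ∀ (b : Fin 12) (v : TensorIndex (Fin 12) 2 → ℂ), (totalSpin 1 2 : Op (Fin 12) 2) *ᵥ v = 0 →
      (-(744800 : ℝ) / 4) * (star (oct12Piece b *ᵥ v) ⬝ᵥ (oct12Piece b *ᵥ v)).re ≤
        (star (oct12Piece b *ᵥ v) ⬝ᵥ pairOp (toPairList 12 it4P (by norm_num)) *ᵥ (oct12Piece b *ᵥ v)).re := by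
    intro b
    fin_cases b
    · exact it4Frame00 (oct12Piece_conjTranspose 0) (oct12Piece_idem 0) (oct12Piece_comm_pairOp 0) (oct12Piece_seam 0)
    · exact it4Frame01 (oct12Piece_conjTranspose 1) (oct12Piece_idem 1) (oct12Piece_comm_pairOp 1) (oct12Piece_seam 1)
    · exact it4Frame02 (oct12Piece_conjTranspose 2) (oct12Piece_idem 2) (oct12Piece_comm_pairOp 2) (oct12Piece_seam 2)
    · exact it4Frame03 (oct12Piece_conjTranspose 3) (oct12Piece_idem 3) (oct12Piece_comm_pairOp 3) (oct12Piece_seam 3)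
    · exact it4Frame04 (oct12Piece_conjTranspose 4) (oct12Piece_idem 4) (oct12Piece_comm_pairOp 4) (oct12Piece_seam 4)
    · exact it4Frame05 (oct12Piece_conjTranspose 5) (oct12Piece_idem 5) (oct12Piece_comm_pairOp 5) (oct12Piece_seam 5)
    · exact it4Frame06 (oct12Piece_conjTranspose 6) (oct12Piece_idem 6) (oct12Piece_comm_pairOp 6) (oct12Piece_seam 6)
    · exact it4Frame07 (oct12Piece_conjTranspose 7) (oct12Piece_idem 7) (oct12Piece_comm_pairOp 7) (oct12Piece_seam 7)
    · exact it4Frame08 (oct12Piece_conjTranspose 8) (oct12Piece_idem 8) (oct12Piece_comm_pairOp 8) (oct12Piece_seam 8)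
    · exact it4Frame09 (oct12Piece_conjTranspose 9) (oct12Piece_idem 9) (oct12Piece_comm_pairOp 9) (oct12Piece_seam 9)
    · exact it4Frame10 (oct12Piece_conjTranspose 10) (oct12Piece_idem 10) (oct12Piece_comm_pairOp 10) (oct12Piece_seam 10)
    · exact it4Frame11 (oct12Piece_conjTranspose 11) (oct12Piece_idem 11) (oct12Piece_comm_pairOp 11) (oct12Piece_seam 11)
  intro b v hv
  have h := key b v hv
  rw [xIt4_eq_two_smul_pairOp, Matrix.smul_mulVec, dotProduct_smul, smul_eq_mul, Complex.mul_re]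
  norm_num at h ⊢
  linarith

/-- **The cluster pair-cut row it4_s4b (HEAD OF RECORD, hypothesis-free)**: for every `L ≥ 4`, in the ground state of the spin-½
Heisenberg antiferromagnet on the `L × L` torus, `−931/5000 ≤ Σ_r 3 A_r c_L(r)` with the seven class sums of the cut
`cut_oct12_adv15oct12it4_s4b.json` b549640712040acb (`c_L(a,b) = heisRedCorr2 L 1 a b`).  From `oct12_it4_s4b_row_of_hblk` and `it4_hblk`. -/
theorem oct12_it4_s4b_row (L : ℕ) (hL : 4 ≤ L) :
    ((-931 : ℝ) / 5000) ≤ 3 * (((35293 : ℝ) / 62500) * heisRedCorr2 L 1 0 1 + ((-5259 : ℝ) / 125000) * heisRedCorr2 L 1 0 2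
      + ((-6057 : ℝ) / 250000) * heisRedCorr2 L 1 0 3 + ((-33673 : ℝ) / 500000) * heisRedCorr2 L 1 1 1
      + ((-221 : ℝ) / 1250) * heisRedCorr2 L 1 1 2 + ((-513 : ℝ) / 125000) * heisRedCorr2 L 1 1 3
      + ((-142 : ℝ) / 15625) * heisRedCorr2 L 1 2 2) :=
  oct12_it4_s4b_row_of_hblk it4_hblk L hL

end Summit.HubbardSuperconductivity.HubbardLadder.ClusterCut
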